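import Mathlib
import HarnessLib
import Summits.NavierStokesRegularity.NavierStokesRegularity.Theorems.TaylorModelRungThreeCertificateReadoutVSoundB
import Summits.NavierStokesRegularity.NavierStokesRegularity.Theorems.TaylorModelRungThreeCertificateFormatVLoopP

/-!
# Crux K1b-DR (stmt-NavierStokesRegularity-23954), line `taylor-model` — v3 read-outs, K-SIDE part 6: the read-out input READ FROM
# THE CHECKPOINTS and the (R4) test MOVED TO THE CHUNK REPLAY (typer g33; fix of the evaluation-order defect found by engine-1 g67 /
# ns-tm-g4 g4, 2026-08-28T12:36–12:37Z)

`CertTablesV.checkReadoutStage` (part 5, `…ReadoutVInterp`) is semantically right but cannot be EVALUATED: `coreVW j s = subStep s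
(nodeAt s)` replays the node recursion from node `0`, so `allN S (testR4 … (coreVW j s))` costs `Σ_s (s+1) ≈ S²/2` core steps per
stage, and `roIn j` (nodes `S−1`, `S`) one full sequential stage inside ONE `native_decide`.  This file changes ONLY the evaluation
order, by computable twins with `_eq` lemmas (no landed statement is touched):

* `hullBox'`, `roIn'`, `roOut'` — the hull boxes / read-out input / read-out output of stage `j` with every node read from the
  CHECKPOINT `(ctxOfW j).startNode s` (the emitted state when node `s` is a chunk start; cert-1 g3 emits nodes `S−1` and `S`) and
  the last core output recomputed from it (`(subStep (S−1) (startNode (S−1))).core`, ONE core step); `hullBox'_eq`, `roIn'_eq`,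
  `roOut'_eq` (propositional equality with the part-5 objects, by engine-1's `StageCtx.startNode_eq_nodeAt`, `…FormatVLoopP`);
* `checkReadoutStage' j := (roOut' j).ok` — the per-sub-step (R4) window test is NO LONGER here: it rides on engine-1's fused chunk
  replay `StageCtx.checkRangeP (fun _ co => testR4 MB (AB j) co)` whose `checkRangeP_sound` delivers it for every sub-step;
  `checkReadouts' := checkReadoutAux A && allN (N₀+1) checkReadoutStage'`;
* `readoutsV_of_checks'` — `readoutsV_of_checks` (part B) with `hchk : checkReadouts = true` replaced by
  `hchk' : checkReadouts' = true` plus the new input `hR4 : ∀ j ≤ N₀, ∀ s < S j, testR4 MB (AB j) (coreVW j s) = true`; proof =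
  rewrite `roOut'_eq` and reuse every clause lemma of parts A/B verbatim.

HONEST FRAMING: kernel bookkeeping for the MODEL certificate №23954 (rung TL-M3); nothing here is a statement about the
Navier–Stokes equations, and nothing about them is asserted.
-/

-- the sub-problem namespace repeats the summit name by design (D-0017)
set_option linter.dupNamespace false

namespace Summit.NavierStokesRegularity.NavierStokesRegularity.Theorems.TaylorModelCert

open scoped BigOperators
open Set
open Literature.Analysis.FluidPDE.TaoCascade Literature.Analysis.FluidPDE.TaoCascade.TaylorChain
open Summit.NavierStokesRegularity.NavierStokesRegularity.Theorems.TaylorModelReadout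
open Summit.NavierStokesRegularity.NavierStokesRegularity.Theorems.TaylorModelV

namespace CertTablesV

section Defs

variable (TV : CertTablesV) (kitOf : ℕ → CoreKit) (wT : ℕ → Array Dyad) (A : ReadoutAux QS2)

/-- Hull box of level `l` at node `(j, s)` READ FROM THE CHECKPOINT: `xD ± radLW l (startNode s)` (cost: no replay when node `s` is
emitted). [folklore] -/
def hullBox' (j : ℕ) (l : Fin 3) (s : ℕ) : Array IntervalD :=
  boxAround TV.base.n (TV.xD j s) (TV.radLW kitOf wT j l ((TV.ctxOfW kitOf wT j).startNode s))

/-- `hullBox'` is the part-5 `hullBox` (the checkpoint is the node state). [folklore] -/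
theorem hullBox'_eq (j : ℕ) (l : Fin 3) (s : ℕ) : TV.hullBox' kitOf wT j l s = TV.hullBox kitOf wT j l s := by
  simp only [hullBox', hullBox, nodeVW, StageCtx.startNode_eq_nodeAt]

/-- **The read-out input of stage `j`, checkpoint form** (last sub-step `S j − 1`): verbatim `roIn` except that the node states at
`S−1` and `S` are `startNode` (emitted) and the last core output is recomputed from `startNode (S−1)` — ONE core step. [folklore] -/
def roIn' (j : ℕ) : ROIn :=
  let st := TV.base.stage j
  let S := st.S
  let J := st.nx
  let sJ := TV.base.stage J
  let nF' := TV.nF j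
  let N := (TV.ctxOfW kitOf wT j).startNode (S - 1)
  let co := ((TV.ctxOfW kitOf wT j).subStep (S - 1) ((TV.ctxOfW kitOf wT j).startNode (S - 1))).core
  { coefB := (kitOf j).coefB, mt := (kitOf j).mt, prec := TV.prec, p := TV.base.pdeg, pV := TV.pdegV,
    x := TV.xD j (S - 1), h := TV.hD j (S - 1),
    H2 := TV.hullBox' kitOf wT j 2 (S - 1), H0 := TV.hullBox' kitOf wT j 0 (S - 1), H1 := TV.hullBox' kitOf wT j 1 (S - 1),
    Ha1 := TV.hullBox' kitOf wT j 1 S,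
    J := co.J, JU := co.JU, ωinvB := TV.ωinvB j,
    Vc := N.Vc, B := N.B, Z := N.Z,
    Wσ := TV.covB st.σf,
    LB := IntervalD.ofQS2 TV.prec st.lev, GB := IntervalD.ofQS2 TV.prec st.γ, ASB := IntervalD.ofQS2 TV.prec st.as,
    AK := IntervalD.ofQS2 TV.prec (st.Λ * st.δ * TV.base.τs * vget st.ω 0),
    rlo := TV.rlo A,
    LvB := IntervalD.ofQS2 TV.prec sJ.Lv, tv := TV.tvD A, nF := nF',
    WJ := TV.faceB J nF', G := TV.partnerG j nF',
    ctrB := TV.listB sJ.ctr nF', radB := TV.listB sJ.rad nF', sB := TV.listB sJ.s nF', βB := TV.listB st.β nF',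
    rPB := TV.partnerR j nF', ρ := (TV.stageV j).rB }

/-- `roIn'` is the part-5 `roIn` (checkpoint = node state; `subStep` from it = the recursion's sub-step). [folklore] -/
theorem roIn'_eq (j : ℕ) : TV.roIn' kitOf wT A j = TV.roIn kitOf wT A j := by
  simp only [roIn', roIn, hullBox'_eq, coreVW, subVW, nodeVW, StageCtx.startNode_eq_nodeAt]

/-- The read-out step output of stage `j`, checkpoint form. [folklore] -/
def roOut' (j : ℕ) : ROOut := TV.base.readoutStep (TV.roIn' kitOf wT A j)

/-- `roOut'` is the part-5 `roOut`. [folklore] -/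
theorem roOut'_eq (j : ℕ) : TV.roOut' kitOf wT A j = TV.roOut kitOf wT A j := by
  simp only [roOut', roOut, roIn'_eq]

/-- **Per-stage read-out check, checkpoint form**: ONLY the read-out step of the last sub-step (the per-sub-step (R4) window test
rides on the chunk replay `StageCtx.checkRangeP`). [folklore] -/
def checkReadoutStage' (j : ℕ) : Bool := (TV.roOut' kitOf wT A j).ok

/-- **All stages, checkpoint form**, plus the surrogate certification. [folklore] -/
def checkReadouts' : Bool :=
  TV.base.checkReadoutAux A && allN (TV.base.N₀ + 1) fun j => TV.checkReadoutStage' kitOf wT A j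

/-- `checkReadoutStage'` is the read-out-step conjunct of the part-5 `checkReadoutStage`. [folklore] -/
theorem checkReadoutStage'_eq (j : ℕ) : TV.checkReadoutStage' kitOf wT A j = (TV.roOut kitOf wT A j).ok := by
  simp only [checkReadoutStage', roOut'_eq]

end Defs

/-! ### The assembly with the (R4) test supplied by the chunk replay -/

variable {TV : CertTablesV} {kitOf : ℕ → CoreKit} {wT : ℕ → Array Dyad} {sc : ScalarsV} {A : ReadoutAux QS2}

/-- **The read-outs of the interpreted v3 certificate from the CHECKPOINT-FORM read-out checks**: as `readoutsV_of_checks`, with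
`checkReadouts' = true` (read-out steps only) and the per-sub-step (R4) window Booleans `hR4` supplied separately (by engine-1's
`StageCtx.checkRangeP_sound` on the fused chunk replay). [folklore] -/
theorem readoutsV_of_checks' (hk : KitOK TV kitOf) (hchk' : TV.checkReadouts' kitOf wT A = true)
    (hR4 : ∀ j, j ≤ TV.base.N₀ → ∀ s, s < (TV.base.stage j).S →
      TV.base.testR4 TV.MB (TV.AB j) (TV.coreVW kitOf wT j s) = true)
    {G : ℕ → ℕ → ℕ → ℝ} {ΛT : ℕ → ℝ}
    (hR0 : ∀ j, j ≤ TV.base.N₀ →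
      (TV.toCertDataVW kitOf wT sc).Tn j ((TV.toCertDataVW kitOf wT sc).S j) ≤ (TV.toCertDataVW kitOf wT sc).τs ∧
      InPoly (TV.toCertDataVW kitOf wT sc) j ((TV.toCertDataVW kitOf wT sc).x j 0) ∧ 0 < (TV.toCertDataVW kitOf wT sc).γ j ∧
      0 ≤ (TV.toReadoutData kitOf wT A G ΛT).ΛT j ∧
      (∀ y : Fin 4 → ℤ → ℝ, (TV.toCertDataVW kitOf wT sc).σf j y = (TV.toCertDataVW kitOf wT sc).σf j (trunc (TV.toCertDataVW kitOf wT sc) y)))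
    (hR1 : ∀ j, j ≤ TV.base.N₀ → ∀ s', s' ≤ (TV.toCertDataVW kitOf wT sc).S j → ∀ y d : Fin 4 → ℤ → ℝ,
      InBox (TV.toCertDataVW kitOf wT sc) ((TV.toBoxesW kitOf wT).hlo 1 j s') ((TV.toBoxesW kitOf wT).hhi 1 j s') y →
      (TV.toCertDataVW kitOf wT sc).InBall j d ((TV.toReadoutData kitOf wT A G ΛT).ΛT j * (TV.toCertDataVW kitOf wT sc).κ j) →
      InBox (TV.toCertDataVW kitOf wT sc) ((TV.toBoxesW kitOf wT).hlo 2 j s') ((TV.toBoxesW kitOf wT).hhi 2 j s') (y + d))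
    (hR2 : ∀ j, j ≤ TV.base.N₀ → ∀ s₀ s₁, s₀ ≤ s₁ → s₁ ≤ (TV.toCertDataVW kitOf wT sc).S j → ∀ Ac : ℕ → Ker,
      (∀ s', s₀ ≤ s' → s' < s₁ → KerMem (TV.toCertDataVW kitOf wT sc) (Ac s') ((TV.toBoxesW kitOf wT).Mlo j s') ((TV.toBoxesW kitOf wT).Mhi j s')) →
      ∀ (v : Fin 4 → ℤ → ℝ) (r : ℝ), 0 ≤ r → (TV.toCertDataVW kitOf wT sc).InBall j v r →
        (TV.toCertDataVW kitOf wT sc).InBall j (kiter (TV.toCertDataVW kitOf wT sc) Ac s₀ (s₁ - s₀) v) ((TV.toReadoutData kitOf wT A G ΛT).G j s₀ s₁ * r))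
    (hR3a : ∀ j, j ≤ TV.base.N₀ → ∀ a b, a < (TV.toCertDataVW kitOf wT sc).S j → a + 1 ≤ b → b ≤ (TV.toCertDataVW kitOf wT sc).S j →
      (TV.toCertDataVW kitOf wT sc).L1 j a * (TV.toReadoutData kitOf wT A G ΛT).G j (a + 1) b ≤ (TV.toReadoutData kitOf wT A G ΛT).ΛT j ∧
      (b < (TV.toCertDataVW kitOf wT sc).S j →
        (TV.toCertDataVW kitOf wT sc).L1 j a * (TV.toReadoutData kitOf wT A G ΛT).G j (a + 1) b * (TV.toCertDataVW kitOf wT sc).L1 j b ≤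
          (TV.toCertDataVW kitOf wT sc).Λ j))
    (hR3b : ∀ j, j ≤ TV.base.N₀ → ∀ a, a < (TV.toCertDataVW kitOf wT sc).S j → (TV.toCertDataVW kitOf wT sc).L1 j a ≤ (TV.toCertDataVW kitOf wT sc).Λ j)
    (hentry : ∀ j, j ≤ TV.base.N₀ → ∀ q ζ : Fin 4 → ℤ → ℝ, InPoly (TV.toCertDataVW kitOf wT sc) j q →
      (∀ i k, -(TV.toCertDataVW kitOf wT sc).Kb ≤ k → k ≤ (TV.toCertDataVW kitOf wT sc).Ka →
        q i k = ((TV.toCertDataVW kitOf wT sc).x j 0 + (TV.toRadiiW kitOf wT).Dsc j ζ) i k) →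
      ∀ c < TV.base.n, |TV.base.wv ζ c| ≤ (dget (TV.stageV j).rB c).toReal) :
    ReadoutsV (TV.toCertDataVW kitOf wT sc) (TV.toBoxesW kitOf wT) (TV.toRadiiW kitOf wT) (TV.toReadoutData kitOf wT A G ΛT) := by
  intro j hj
  have hjN : j ≤ TV.base.N₀ := hj
  unfold checkReadouts' at hchk'
  simp only [Bool.and_eq_true] at hchk'
  obtain ⟨hAux, hall⟩ := hchk'
  have hok : (TV.roOut kitOf wT A j).ok = true := by
    rw [← checkReadoutStage'_eq]
    exact (allN_eq_true.1 hall) j (Nat.lt_succ_of_le hjN)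
  have h4 : allN (TV.base.stage j).S (fun s => TV.base.testR4 TV.MB (TV.AB j) (TV.coreVW kitOf wT j s)) = true :=
    allN_eq_true.2 fun s hs => hR4 j hjN s hs
  obtain ⟨h0a, h0b, h0c, h0d, h0e⟩ := hR0 j hjN
  exact ⟨h0a, h0b, h0c, h0d, h0e, hR1 j hjN, hR2 j hjN, hR3a j hjN, hR3b j hjN, readout_R4 h4, (readout_R5 hok).1, (readout_R5 hok).2,
    readout_R6 hk, readout_R7 hk hok, readout_R8 hAux hok, readout_R9 hAux hok, readout_R10 hk, readout_R11 hk hAux hok (hentry j hjN)⟩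

end CertTablesV

end Summit.NavierStokesRegularity.NavierStokesRegularity.Theorems.TaylorModelCert
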